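import Literature.AlgebraicGeometry.HodgeTheory.MonodromyWeightFiltrationSl2
import HarnessLib

/-!
# The monodromy weight filtration: change of centre and of scalar

Two book-keeping facts about the tree's `IsMonodromyWeightFiltration N c W` ("`W = W(N)[-c]`",
`MonodromyWeightFiltration.lean`) and the definition `monodromyWeightFiltration N hN c`
(`MonodromyWeightFiltrationSl2.lean`, §4), both absent so far:

* **Scalars** (Deligne, *La conjecture de Weil II*, (1.6.14), p. 169: in the applications one has
  "non pas un endomorphisme nilpotent `N` de `V`, mais une action nilpotente d'une algèbre de Lie
  `𝔫` de dimension 1. La théorie précédente s'applique dès qu'on choisit `N ≠ 0` dans `𝔫` …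
  l'existence de la filtration `M`, et cette filtration même, si elle existe, sont indépendantes du
  choix de `N`"): `W(aN) = W(N)` for every unit `a` — `IsMonodromyWeightFiltration.smul`,
  `isMonodromyWeightFiltration_smul_iff`, `monodromyWeightFiltration_smul`. The case `a = -1` is the
  tree's `IsMonodromyWeightFiltration.neg` (`MonodromyWeightFiltrationSumDual.lean`); for the limit
  mixed Hodge structure, whose `N` is pinned by the geometry only up to a positive rational factor
  and a sign (`LimitMixedHodgeStructure.lean`: "`W(N) = W(-N)`"), this says `W` does not see the
  normalisation of `N`.
* **Centre** (Cattani–El Zein–Griffiths–Lê, Def. 7.5.9 (2): "`W = W(N)[-k]`, where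
  `W[-k]_ℓ = W_{ℓ-k}`"; Deligne, (1.6.13), proof: "un décalage simultané, de même amplitude, sur les
  filtrations … respecte la condition"): re-indexing `i ↦ W_{i+s}` turns the monodromy weight
  filtration centred at `c` into the one centred at `c - s` — `IsMonodromyWeightFiltration.shift`,
  `isMonodromyWeightFiltration_shift_iff`, `monodromyWeightFiltration_shift`. With `s = 2j` this is
  the weight filtration of the Tate twist `H(j)` of a limit mixed Hodge structure
  (`W_i H(j) = W_{i+2j} H`, Cattani et al., Ex. 3.2.23 (4)).

## References

* [Deligne1980] P. Deligne, *La conjecture de Weil. II*, Publ. Math. IHÉS 52 (1980), (1.6.13),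
  (1.6.14), pp. 168–169.
* [CattaniElZeinGriffithsLe2014] E. Cattani et al. (eds.), *Hodge Theory* (2014), Def. 7.5.9 (2),
  p. 305; Ex. 3.2.23 (4), p. 163; Prop. A.2.2.
-/

namespace Literature.AlgebraicGeometry.HodgeTheory

universe u v

/-! ### Scalars: `W(aN) = W(N)` for a unit `a` -/

section Smul

variable {R : Type u} [CommRing R] {V : Type v} [AddCommGroup V] [Module R V]
variable {N : V →ₗ[R] V} {c : ℤ} {W : ℤ → Submodule R V}

/-- `p.map (a • f) ≤ p.map f` for any scalar `a`. [folklore] -/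
private theorem map_smul_le (a : R) (f : V →ₗ[R] V) (p : Submodule R V) :
    p.map (a • f) ≤ p.map f := by
  rintro _ ⟨x, hx, rfl⟩
  exact Submodule.smul_mem _ a (Submodule.mem_map_of_mem hx)

/-- `p.map (a • f) = p.map f` for a unit `a`. [folklore] -/
private theorem map_smul_of_isUnit {a : R} (ha : IsUnit a) (f : V →ₗ[R] V) (p : Submodule R V) :
    p.map (a • f) = p.map f := by
  refine le_antisymm (map_smul_le a f p) ?_
  obtain ⟨u, rfl⟩ := ha
  have h := map_smul_le (V := V) (↑u⁻¹ : R) ((u : R) • f) p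
  rwa [smul_smul, Units.inv_mul, one_smul] at h

/-- `q.comap (a • f) = q.comap f` for a unit `a`. [folklore] -/
private theorem comap_smul_of_isUnit {a : R} (ha : IsUnit a) (f : V →ₗ[R] V) (q : Submodule R V) :
    q.comap (a • f) = q.comap f := by
  obtain ⟨u, rfl⟩ := ha
  ext x
  simp only [Submodule.mem_comap, LinearMap.smul_apply]
  refine ⟨fun h => ?_, fun h => q.smul_mem _ h⟩
  have h' := q.smul_mem (↑u⁻¹ : R) h
  rwa [smul_smul, Units.inv_mul, one_smul] at h'

/-- **The monodromy weight filtration does not depend on the normalisation of `N`**: if `W` is the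
monodromy weight filtration of `N` centred at `c`, it is also that of `aN` for every unit `a`
(Deligne, Weil II, (1.6.14): "l'existence de la filtration `M`, et cette filtration même … sont
indépendantes du choix de `N`" in the line it spans). `N (W_i) = aN (W_i)` and `(aN)^ℓ = a^ℓ N^ℓ`
with `a^ℓ` a unit. [cite: Deligne1980, (1.6.14), p. 169] -/
theorem IsMonodromyWeightFiltration.smul (hW : IsMonodromyWeightFiltration N c W) {a : R}
    (ha : IsUnit a) : IsMonodromyWeightFiltration (a • N) c W where
  monotone := hW.monotone
  exists_eq_bot := hW.exists_eq_bot
  exists_eq_top := hW.exists_eq_top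
  map_le i := (map_smul_le a N (W i)).trans (hW.map_le i)
  inf_comap_le ℓ := by
    rw [smul_pow, comap_smul_of_isUnit (ha.pow ℓ)]
    exact hW.inf_comap_le ℓ
  le_map_sup ℓ := by
    rw [smul_pow, map_smul_of_isUnit (ha.pow ℓ)]
    exact hW.le_map_sup ℓ

/-- `W` is the monodromy weight filtration of `aN` (centred at `c`) iff it is that of `N`, for a
unit `a`. [cite: Deligne1980, (1.6.14), p. 169] -/
theorem isMonodromyWeightFiltration_smul_iff {a : R} (ha : IsUnit a) :
    IsMonodromyWeightFiltration (a • N) c W ↔ IsMonodromyWeightFiltration N c W := by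
  refine ⟨fun h => ?_, fun h => h.smul ha⟩
  obtain ⟨u, rfl⟩ := ha
  have h' := h.smul (u⁻¹).isUnit
  rwa [smul_smul, Units.inv_mul, one_smul] at h'

end Smul

section SmulDefinition

variable {k : Type u} [Field k] [CharZero k] {V : Type v} [AddCommGroup V] [Module k V]
  [FiniteDimensional k V]

/-- **`W(aN)[-c] = W(N)[-c]` for `a ≠ 0`** (Deligne, Weil II, (1.6.14); by uniqueness, Cattani et al.,
Prop. A.2.2), for the tree's definition `monodromyWeightFiltration` and any proof of nilpotency of
`aN` (e.g. Mathlib's `hN.smul a`). [cite: Deligne1980, (1.6.14), p. 169] -/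
theorem monodromyWeightFiltration_smul (N : Module.End k V) (hN : IsNilpotent N) (c : ℤ) {a : k}
    (ha : a ≠ 0) (haN : IsNilpotent (a • N)) :
    monodromyWeightFiltration (a • N) haN c = monodromyWeightFiltration N hN c :=
  ((isMonodromyWeightFiltration_monodromyWeightFiltration N hN c).smul
    (isUnit_iff_ne_zero.2 ha)).eq_monodromyWeightFiltration haN |>.symm

/-- `W(-N)[-c] = W(N)[-c]` for the tree's definition (the sign of the monodromy logarithm is
immaterial; cf. `IsMonodromyWeightFiltration.neg`). [cite: Deligne1980, (1.6.14), p. 169] -/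
theorem monodromyWeightFiltration_neg (N : Module.End k V) (hN : IsNilpotent N) (c : ℤ)
    (hN' : IsNilpotent (-N)) :
    monodromyWeightFiltration (-N) hN' c = monodromyWeightFiltration N hN c := by
  have h := (isMonodromyWeightFiltration_monodromyWeightFiltration N hN c).smul
    (isUnit_one.neg : IsUnit (-1 : k))
  rw [neg_one_smul] at h
  exact (h.eq_monodromyWeightFiltration hN').symm

end SmulDefinition

/-! ### Centre: re-indexing shifts the centre -/

section Shift

variable {R : Type u} [CommRing R] {V : Type v} [AddCommGroup V] [Module R V]
variable {N : V →ₗ[R] V} {c : ℤ} {W : ℤ → Submodule R V}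

/-- **Re-indexing a monodromy weight filtration shifts its centre**: if `W` is the monodromy weight
filtration of `N` centred at `c`, then `i ↦ W_{i+s}` is the one centred at `c - s` (the convention
`W = W(N)[-k]`, `W[-k]_ℓ = W_{ℓ-k}` of Cattani et al., Def. 7.5.9 (2); Deligne, (1.6.13), proof:
"un décalage simultané, de même amplitude … respecte la condition"). With `s = 2j`: the weight
filtration `W_i H(j) = W_{i+2j} H` of a Tate twist is centred at `k - 2j`.
[cite: CattaniElZeinGriffithsLe2014, Def. 7.5.9 (2), p. 305] -/
theorem IsMonodromyWeightFiltration.shift (hW : IsMonodromyWeightFiltration N c W) (s : ℤ) :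
    IsMonodromyWeightFiltration N (c - s) (fun i => W (i + s)) where
  monotone _ _ h := hW.monotone (by omega)
  exists_eq_bot := by
    obtain ⟨i, hi⟩ := hW.exists_eq_bot
    exact ⟨i - s, by simpa using hi⟩
  exists_eq_top := by
    obtain ⟨i, hi⟩ := hW.exists_eq_top
    exact ⟨i - s, by simpa using hi⟩
  map_le i := (hW.map_le (i + s)).trans (le_of_eq (by congr 1; ring))
  inf_comap_le ℓ := by
    show W (c - s + ℓ + s) ⊓ (W (c - s - ℓ - 1 + s)).comap (N ^ ℓ) ≤ W (c - s + ℓ - 1 + s)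
    rw [show c - s + (ℓ : ℤ) + s = c + ℓ by ring, show c - s - (ℓ : ℤ) - 1 + s = c - ℓ - 1 by ring,
      show c - s + (ℓ : ℤ) - 1 + s = c + ℓ - 1 by ring]
    exact hW.inf_comap_le ℓ
  le_map_sup ℓ := by
    show W (c - s - ℓ + s) ≤ (W (c - s + ℓ + s)).map (N ^ ℓ) ⊔ W (c - s - ℓ - 1 + s)
    rw [show c - s - (ℓ : ℤ) + s = c - ℓ by ring, show c - s + (ℓ : ℤ) + s = c + ℓ by ring,
      show c - s - (ℓ : ℤ) - 1 + s = c - ℓ - 1 by ring]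
    exact hW.le_map_sup ℓ

/-- `i ↦ W_{i+s}` is the monodromy weight filtration centred at `c - s` iff `W` is the one centred
at `c`. [cite: CattaniElZeinGriffithsLe2014, Def. 7.5.9 (2), p. 305] -/
theorem isMonodromyWeightFiltration_shift_iff (s : ℤ) :
    IsMonodromyWeightFiltration N (c - s) (fun i => W (i + s)) ↔ IsMonodromyWeightFiltration N c W := by
  refine ⟨fun h => ?_, fun h => h.shift s⟩
  have h' := h.shift (-s)
  simp only [sub_neg_eq_add, sub_add_cancel, neg_add_cancel_right] at h'
  exact h'

/-- The centre is determined up to the indexing: `W` centred at `c` is `i ↦ W_{i+(c-c')}` re-centred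
at `c'`. [cite: CattaniElZeinGriffithsLe2014, Def. 7.5.9 (2), p. 305] -/
theorem IsMonodromyWeightFiltration.shift_of_eq (hW : IsMonodromyWeightFiltration N c W) (c' : ℤ) :
    IsMonodromyWeightFiltration N c' (fun i => W (i + (c - c'))) := by
  have h := hW.shift (c - c')
  rwa [sub_sub_cancel] at h

end Shift

section ShiftDefinition

variable {k : Type u} [Field k] [CharZero k] {V : Type v} [AddCommGroup V] [Module k V]
  [FiniteDimensional k V]

/-- **`W(N)[-(c - s)]_i = W(N)[-c]_{i+s}`** for the tree's definition: all the centred filtrations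
are shifts of one another (Cattani et al., Def. 7.5.9 (2): `W[-k]_ℓ = W_{ℓ-k}`).
[cite: CattaniElZeinGriffithsLe2014, Def. 7.5.9 (2), p. 305] -/
theorem monodromyWeightFiltration_shift (N : Module.End k V) (hN : IsNilpotent N) (c s i : ℤ) :
    monodromyWeightFiltration N hN (c - s) i = monodromyWeightFiltration N hN c (i + s) :=
  congr_fun ((isMonodromyWeightFiltration_monodromyWeightFiltration N hN (c - s)).unique
    ((isMonodromyWeightFiltration_monodromyWeightFiltration N hN c).shift s)) i

/-- `W(N)[-c]_i = W(N)[0]_{i-c}` ("`W[-k]_ℓ = W_{ℓ-k}`" literally, with `W = W(N)` centred at `0`).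
[cite: CattaniElZeinGriffithsLe2014, Def. 7.5.9 (2), p. 305] -/
theorem monodromyWeightFiltration_eq_shift_zero (N : Module.End k V) (hN : IsNilpotent N) (c i : ℤ) :
    monodromyWeightFiltration N hN c i = monodromyWeightFiltration N hN 0 (i - c) := by
  have h := monodromyWeightFiltration_shift N hN 0 (-c) i
  simp only [zero_sub, neg_neg] at h
  rw [h, sub_eq_add_neg]

end ShiftDefinition

end Literature.AlgebraicGeometry.HodgeTheory
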